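import Summits.ValiantsHypothesis.ValiantsHypothesis.Theorems.GrenetZeonDualUnipotentThreeHalvesLongMassValueSpaceFree
import Summits.ValiantsHypothesis.ValiantsHypothesis.Theorems.GrenetZeonDualUnipotentThreeHalvesLongMassValueSpace

/-!
# `GrenetZeon.DualUnipotentThreeHalves` (stmt-ValiantsHypothesis-24318), line `slow_core`, stub (c) `SlowCore.LongMassSlowLawInv`:
# (c) ⟺ (c) FOR FREE LINEAR NILPOTENT PENCILS (by-name corollary)

Composition of ✓ `…LongMassHomogenise` (`longMassSlowLawAll_of_linear`: constant part free), ✓ `…LongMassValueSpace`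
(`relCert_of_valueSpace`: the price is an invariant of the value space) and ✓ `…LongMassValueSpaceFree` (`exists_free_of_linear`,
`pow_eq_zero_of_valueSpace_le`: every linear pencil has a FREE re-parametrisation with the same value space, nilpotency is inherited):
★★★ `longMassSlowLawAll_iff_free` / `longMassSlowLawInv_iff_free` — the registered research statement (c) holds iff it holds for FREE LINEAR
nilpotent pencils (constant part `0`, non-zero coefficient matrices linearly independent: `linMat B v = 0 → ∀ e, linMat B δ_e ≠ 0 → v e = 0`),
constants `c ↦ 2c`, `n₀ ↦ max n₀ 1`.  Reading: «∃ c n₀, ∀ n ≥ n₀, every nilpotent matrix subspace `W̄ ≤ M_b(ℂ)` with `dim W̄ ≤ n²`, written in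
ANY basis placed on distinct coordinates, has a whole-pencil certificate of price `≤ c·√n·b`» — mass = `dim W̄`, no parametrisation artefacts.

Honest framing.  A REFORMULATION (`--supports stmt-ValiantsHypothesis-24318`), NOT progress on (c): (c) `SlowCore.LongMassSlowLawInv`, S3, the
crux 24318, 8062 and `VP ≠ VNP` remain OPEN / NOT proved.  No sorry, no definitions, no named facts.
-/

-- single-conjunct layout: Sub = Summit, duplicated namespace component intended (the name is mandated)
set_option linter.dupNamespace false
set_option autoImplicit false

noncomputable section

namespace Summit.ValiantsHypothesis.ValiantsHypothesis.Theorems.GrenetZeon.LongMassHomogenise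

open MvPolynomial Matrix
open scoped BigOperators
open Summit.ValiantsHypothesis.ValiantsHypothesis.Cruxes.TwoDimCoefficients.DimTwoCases (AffMat IsAffine)
open Summit.ValiantsHypothesis.ValiantsHypothesis.Theorems.GrenetZeon.SlowCore
open Summit.ValiantsHypothesis.ValiantsHypothesis.Theorems.GrenetZeon.ResolventFlag (linMat)
open Summit.ValiantsHypothesis.ValiantsHypothesis.Theorems.GrenetZeon.LongMassIrreducibilityFree
  (LongMassSlowLawAll inv_of_all all_of_inv)

variable {n b : ℕ}

/-! ## §3 (c) ⟺ (c) for FREE linear pencils -/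

/-- ★★★ **(c) ⟺ (c) FOR FREE LINEAR NILPOTENT PENCILS** (`LongMassSlowLawAll` form; constants `c ↦ 2c`, `n₀ ↦ max n₀ 1`). -/
theorem longMassSlowLawAll_iff_free :
    LongMassSlowLawAll ↔
      ∃ c n₀ : ℕ, ∀ n ≥ n₀, ∀ b : ℕ, ∀ B : AffMat n b, IsAffine B → (∀ i j, coeff 0 (B i j) = 0) →
        (∀ v, linMat B v = 0 → ∀ e, linMat B (Pi.single e 1) ≠ 0 → v e = 0) → B ^ b = 0 →
        RelCert n b B (c * (Nat.sqrt n * b)) := by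
  constructor
  · rintro ⟨c, n₀, h⟩
    exact ⟨c, n₀, fun n hn b B hB _ _ hnil => h n hn b B hB hnil⟩
  · rintro ⟨c, n₀, h⟩
    refine longMassSlowLawAll_of_linear (c := c) (n₀ := n₀) fun n hn b B hB h0 hnil => ?_
    obtain ⟨N₁, hN₁, h0₁, hle, hge, hfree⟩ := exists_free_of_linear B
    have hnil₁ : N₁ ^ b = 0 := pow_eq_zero_of_valueSpace_le B N₁ hB hN₁ h0 h0₁ hge hnil
    exact relCert_of_valueSpace B N₁ hB hN₁ h0 h0₁ hle hge (h n hn b N₁ hN₁ h0₁ hfree hnil₁)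

/-- ★★★ **(c) ⟺ (c) FOR FREE LINEAR NILPOTENT PENCILS** (the registered stub's `SlowCore.LongMassSlowLawInv` form). -/
theorem longMassSlowLawInv_iff_free :
    LongMassSlowLawInv ↔
      ∃ c n₀ : ℕ, ∀ n ≥ n₀, ∀ b : ℕ, ∀ B : AffMat n b, IsAffine B → (∀ i j, coeff 0 (B i j) = 0) →
        (∀ v, linMat B v = 0 → ∀ e, linMat B (Pi.single e 1) ≠ 0 → v e = 0) → B ^ b = 0 →
        RelCert n b B (c * (Nat.sqrt n * b)) := by
  rw [← longMassSlowLawAll_iff_free]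
  exact ⟨all_of_inv, inv_of_all⟩

end Summit.ValiantsHypothesis.ValiantsHypothesis.Theorems.GrenetZeon.LongMassHomogenise

end
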